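import Summits.CriticalPhenomena.PercolationContinuityZ3.Theorems.PercNearOneGluingNoHeavyLowerTailSahiOneStepThresholdStep
import Summits.CriticalPhenomena.PercolationContinuityZ3.Theorems.PercNearOneGluingNoHeavyLowerTailSahiOneStepSubblockThresholdFree
import HarnessLib

/-!
# One-step scheme, `(2′)` half at uniform density — preliminaries: the `H`-generated hull and the CROSS-FORM step lemma

Support file (prover prim-ineq-prove-3 gen 21; `--supports stmt-CriticalPhenomena-4575`; memo
`run/shared/lean/prim/prim-ineq-prove-3/PROOF-2PRIME-UNIFORM.md`, Lemmas 2 and 5).  No definitions, no named facts, no sorries, no `native_decide`.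

Setting (`…SahiOneStepCone`): `μ = prodBernoulli p`, first slot `H`, `n(H;A,B) = osN p H (ind A) (ind B)`; for a coordinate `e` the sections
`X¹ = {ω | insert e ω ∈ X}`, `X⁰ = {ω | ω ∖ {e} ∈ X}` (written out in full; no definitions).

* **`H`-generated hull** `A* = {ω | every ω' ⊇ ω with ω' ∈ H lies in A}` (written out in full): it is increasing, contains the increasing event `A`,
  has the same trace on `H` (`inter_hgen_eq`), is determined by any block determining `H` and `A` (`determinedBy_hgen`), and — the point —
  **`n(H; A*, B) ≤ n(H; A, B)`** for increasing `H, A, B` (`osN_ind_ind_hgen_le`): with the `H`-traces fixed, `n` is affine in `μ(A ∖ H)` with slope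
  `−Cov(1_B, 1_H) ≤ 0` (Harris).  Memo Lemma 2 (valid for every product measure).
* **Cross-form step lemma** (`osN_ind_ind_nonneg_of_cross`): from the pivot identity `osN_ind_ind_pivot_eq` (gen 19), if both section triples have
  `n ≥ 0`, the sections are monotone, `μH¹ < 1`, `μH⁰ < 1`, and the two "ball-conditioned section drifts"
  `U_X = (1−μH⁰)(μX¹−μ(H¹∩X¹)) − (1−μH¹)(μX⁰−μ(H⁰∩X⁰))` satisfy `U_A ≥ 0 ≥ U_B`, then `n(H;A,B) ≥ 0`.  Memo Lemma 5 + §3 (the polynomial identity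
  `ℓ¹ℓ⁰·(p M₂ + q M₁) = (ℓ⁰)² n¹ + (ℓ¹)² n⁰ + ℓ¹ℓ⁰(pℓ¹+qℓ⁰)·ΔA·ΔB − U_A·U_B`).
-/

noncomputable section

namespace Summit.CriticalPhenomena.PercolationContinuityZ3.Theorems

namespace SahiOneStep

open MeasureTheory
open Literature.Probability.Percolation (DeterminedBy determinedBy_iff)
open Literature.Probability.LatticeModels (prodBernoulli prodBernoulli_harris)
open Literature.Probability.Percolation.DecisionTree (ind)
open scoped Classical

variable {ι : Type*} [Fintype ι]

/-! ## The `H`-generated hull of an increasing event -/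

omit [Fintype ι] in
/-- The `H`-generated hull is an increasing event. [this work] -/
theorem isUpperSet_hgen (H A : Set (Set ι)) :
    IsUpperSet {ω : Set ι | ∀ ω' : Set ι, ω ⊆ ω' → ω' ∈ H → ω' ∈ A} :=
  fun _ _ h12 h1 ω' h2 hH => h1 ω' (h12.trans h2) hH

omit [Fintype ι] in
/-- An increasing event lies inside its `H`-generated hull. [this work] -/
theorem subset_hgen (H : Set (Set ι)) {A : Set (Set ι)} (hA : IsUpperSet A) :
    A ⊆ {ω : Set ι | ∀ ω' : Set ι, ω ⊆ ω' → ω' ∈ H → ω' ∈ A} :=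
  fun _ hω _ hωω' _ => hA hωω' hω

omit [Fintype ι] in
/-- The hull has the same trace on `H` as the event. [this work] -/
theorem inter_hgen_eq (H : Set (Set ι)) {A : Set (Set ι)} (hA : IsUpperSet A) :
    H ∩ {ω : Set ι | ∀ ω' : Set ι, ω ⊆ ω' → ω' ∈ H → ω' ∈ A} = H ∩ A := by
  ext ω
  constructor
  · rintro ⟨hH, hg⟩
    exact ⟨hH, hg ω subset_rfl hH⟩
  · rintro ⟨hH, hAω⟩
    exact ⟨hH, subset_hgen H hA hAω⟩

omit [Fintype ι] in
/-- The hull has the same trace on `H ∩ B` as the event. [this work] -/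
theorem inter_hgen_inter_eq (H B : Set (Set ι)) {A : Set (Set ι)} (hA : IsUpperSet A) :
    H ∩ {ω : Set ι | ∀ ω' : Set ι, ω ⊆ ω' → ω' ∈ H → ω' ∈ A} ∩ B = H ∩ A ∩ B := by
  rw [inter_hgen_eq H hA]

omit [Fintype ι] in
/-- The hull of an `F`-determined event (for an `F`-determined slot) is `F`-determined. [this work] -/
theorem determinedBy_hgen {H A : Set (Set ι)} {F : Set ι} (hH : DeterminedBy H F) (hA : DeterminedBy A F) :
    DeterminedBy {ω : Set ι | ∀ ω' : Set ι, ω ⊆ ω' → ω' ∈ H → ω' ∈ A} F := by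
  rw [determinedBy_iff] at hH hA ⊢
  -- one direction suffices by symmetry
  suffices key : ∀ ω₁ ω₂ : Set ι, ω₁ ∩ F = ω₂ ∩ F →
      ω₁ ∈ {ω : Set ι | ∀ ω' : Set ι, ω ⊆ ω' → ω' ∈ H → ω' ∈ A} →
      ω₂ ∈ {ω : Set ι | ∀ ω' : Set ι, ω ⊆ ω' → ω' ∈ H → ω' ∈ A} by
    intro ω₁ ω₂ h12
    exact ⟨key ω₁ ω₂ h12, key ω₂ ω₁ h12.symm⟩
  intro ω₁ ω₂ h12 h1 ω₂' h22' hH2'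
  -- transplant `ω₂'` onto `ω₁` off `F`
  set ω₁' : Set ι := (ω₂' ∩ F) ∪ (ω₁ \ F) with hω₁'
  have hagree : ω₁' ∩ F = ω₂' ∩ F := by
    ext i
    simp only [hω₁', Set.mem_inter_iff, Set.mem_union, Set.mem_sdiff]
    tauto
  have hsub : ω₁ ⊆ ω₁' := by
    intro i hi
    by_cases hiF : i ∈ F
    · have : i ∈ ω₂ ∩ F := by rw [← h12]; exact ⟨hi, hiF⟩
      exact Or.inl ⟨h22' this.1, hiF⟩
    · exact Or.inr ⟨hi, hiF⟩
  have hH1' : ω₁' ∈ H := (hH ω₁' ω₂' hagree).2 hH2'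
  exact (hA ω₁' ω₂' hagree).1 (h1 ω₁' hsub hH1')

/-- **`H`-generation does not increase `n`** (memo Lemma 2): for increasing `H, A, B`, `n(H; A*, B) ≤ n(H; A, B)`.  With the traces on `H`
fixed, `n` is affine in `μ(A)` with slope `μ(H)μ(B) − μ(H∩B) = −Cov(1_B,1_H) ≤ 0` (Harris), and `μ(A) ≤ μ(A*)`. [this work] -/
theorem osN_ind_ind_hgen_le (p : ι → unitInterval) {H A B : Set (Set ι)} (hH : IsUpperSet H) (hA : IsUpperSet A)
    (hB : IsUpperSet B) :
    osN p H (ind {ω : Set ι | ∀ ω' : Set ι, ω ⊆ ω' → ω' ∈ H → ω' ∈ A}) (ind B) ≤ osN p H (ind A) (ind B) := by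
  rw [osN_ind_ind, osN_ind_ind, inter_hgen_inter_eq H B hA, inter_hgen_eq H hA]
  have hmono : (prodBernoulli p).real A ≤ (prodBernoulli p).real {ω : Set ι | ∀ ω' : Set ι, ω ⊆ ω' → ω' ∈ H → ω' ∈ A} :=
    measureReal_mono (subset_hgen H hA)
  have hHarris : (prodBernoulli p).real H * (prodBernoulli p).real B ≤ (prodBernoulli p).real (H ∩ B) :=
    prodBernoulli_harris p hH hB MeasurableSet.of_discrete MeasurableSet.of_discrete
  nlinarith [hmono, hHarris]

/-- The symmetric form: `n(H; A, B*) ≤ n(H; A, B)`. [this work] -/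
theorem osN_ind_ind_hgen_le_right (p : ι → unitInterval) {H A B : Set (Set ι)} (hH : IsUpperSet H) (hA : IsUpperSet A)
    (hB : IsUpperSet B) :
    osN p H (ind A) (ind {ω : Set ι | ∀ ω' : Set ι, ω ⊆ ω' → ω' ∈ H → ω' ∈ B}) ≤ osN p H (ind A) (ind B) := by
  rw [osN_comm p H (ind A), osN_comm p H (ind A)]
  exact osN_ind_ind_hgen_le p hH hB hA

/-! ## The cross-form step lemma -/

/-- **The cross-form step inequality, real-variable form** (memo §3): with `ℓ¹ = 1 − h₁`, `ℓ⁰ = 1 − h₀`,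
`ℓ¹ℓ⁰·(P·M₂ + Q·M₁) = (ℓ⁰)²·n¹ + (ℓ¹)²·n⁰ + ℓ¹ℓ⁰(Pℓ¹+Qℓ⁰)·(a₁−a₀)(b₁−b₀) − U_A·U_B`, so `n¹, n⁰ ≥ 0`, monotone sections and
`U_A ≥ 0 ≥ U_B` make the Bernstein form of the pivot identity nonnegative. [this work] -/
theorem cross_step_real (P N1 N0 h1 h0 a1 a0 b1 b0 ha1 ha0 hb1 hb0 hab1 hab0 : ℝ)
    (hp0 : 0 ≤ P) (hq0 : 0 ≤ 1 - P) (hl1 : h1 < 1) (hl0 : h0 < 1)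
    (e1 : N1 = ha1 * hb1 + (1 - h1) * hab1 + h1 * a1 * b1 - ha1 * b1 - hb1 * a1)
    (e0 : N0 = ha0 * hb0 + (1 - h0) * hab0 + h0 * a0 * b0 - ha0 * b0 - hb0 * a0)
    (hn1 : 0 ≤ N1) (hn0 : 0 ≤ N0) (hA : a0 ≤ a1) (hB : b0 ≤ b1)
    (hUA : 0 ≤ (1 - h0) * (a1 - ha1) - (1 - h1) * (a0 - ha0))
    (hUB : (1 - h0) * (b1 - hb1) - (1 - h1) * (b0 - hb0) ≤ 0) :
    0 ≤ P ^ 2 * N1 + (1 - P) ^ 2 * N0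
      + P * (1 - P) *
        (P * ((a0 - ha0) * (b1 - hb1) + (a1 - ha1) * (b0 - hb0) + (1 - h0) * hab1 + (1 - h1) * hab0
              - (h1 - h0) * a1 * b1 - (1 - h1) * (a1 * b0 + a0 * b1))
          + (1 - P) * ((a0 - ha0) * (b1 - hb1) + (a1 - ha1) * (b0 - hb0) + (1 - h0) * hab1 + (1 - h1) * hab0
              - (h1 - h0) * a1 * b1 - (1 - h1) * (a1 * b0 + a0 * b1)
              + (h1 - h0) * (a1 - a0) * (b1 - b0))) := by
  have hL1 : 0 < 1 - h1 := sub_pos.2 hl1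
  have hL0 : 0 < 1 - h0 := sub_pos.2 hl0
  -- the polynomial identity (multiply by `ℓ¹ℓ⁰ > 0`)
  have key : (1 - h1) * (1 - h0) *
      (P ^ 2 * N1 + (1 - P) ^ 2 * N0
        + P * (1 - P) *
          (P * ((a0 - ha0) * (b1 - hb1) + (a1 - ha1) * (b0 - hb0) + (1 - h0) * hab1 + (1 - h1) * hab0
                - (h1 - h0) * a1 * b1 - (1 - h1) * (a1 * b0 + a0 * b1))
            + (1 - P) * ((a0 - ha0) * (b1 - hb1) + (a1 - ha1) * (b0 - hb0) + (1 - h0) * hab1 + (1 - h1) * hab0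
                - (h1 - h0) * a1 * b1 - (1 - h1) * (a1 * b0 + a0 * b1)
                + (h1 - h0) * (a1 - a0) * (b1 - b0)))) =
      (1 - h1) * (1 - h0) * (P ^ 2 * N1 + (1 - P) ^ 2 * N0)
        + P * (1 - P) *
          ((1 - h0) ^ 2 * N1 + (1 - h1) ^ 2 * N0
            + (1 - h1) * (1 - h0) * (P * (1 - h1) + (1 - P) * (1 - h0)) * ((a1 - a0) * (b1 - b0))
            + -(((1 - h0) * (a1 - ha1) - (1 - h1) * (a0 - ha0)) * ((1 - h0) * (b1 - hb1) - (1 - h1) * (b0 - hb0)))) := by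
    rw [e1, e0]; ring
  have t1 : 0 ≤ (1 - h1) * (1 - h0) * (P ^ 2 * N1 + (1 - P) ^ 2 * N0) :=
    mul_nonneg (mul_nonneg hL1.le hL0.le) (add_nonneg (mul_nonneg (pow_nonneg hp0 2) hn1) (mul_nonneg (pow_nonneg hq0 2) hn0))
  have t2 : 0 ≤ (1 - h0) ^ 2 * N1 := mul_nonneg (pow_nonneg hL0.le 2) hn1
  have t3 : 0 ≤ (1 - h1) ^ 2 * N0 := mul_nonneg (pow_nonneg hL1.le 2) hn0
  have t4 : 0 ≤ (1 - h1) * (1 - h0) * (P * (1 - h1) + (1 - P) * (1 - h0)) * ((a1 - a0) * (b1 - b0)) :=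
    mul_nonneg (mul_nonneg (mul_nonneg hL1.le hL0.le) (add_nonneg (mul_nonneg hp0 hL1.le) (mul_nonneg hq0 hL0.le)))
      (mul_nonneg (sub_nonneg.2 hA) (sub_nonneg.2 hB))
  have t5 : 0 ≤ -(((1 - h0) * (a1 - ha1) - (1 - h1) * (a0 - ha0)) * ((1 - h0) * (b1 - hb1) - (1 - h1) * (b0 - hb0))) :=
    neg_nonneg.2 (mul_nonpos_iff.2 (Or.inl ⟨hUA, hUB⟩))
  have hrhs : 0 ≤ (1 - h1) * (1 - h0) * (P ^ 2 * N1 + (1 - P) ^ 2 * N0)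
        + P * (1 - P) *
          ((1 - h0) ^ 2 * N1 + (1 - h1) ^ 2 * N0
            + (1 - h1) * (1 - h0) * (P * (1 - h1) + (1 - P) * (1 - h0)) * ((a1 - a0) * (b1 - b0))
            + -(((1 - h0) * (a1 - ha1) - (1 - h1) * (a0 - ha0)) * ((1 - h0) * (b1 - hb1) - (1 - h1) * (b0 - hb0)))) :=
    add_nonneg t1 (mul_nonneg (mul_nonneg hp0 hq0) (add_nonneg (add_nonneg (add_nonneg t2 t3) t4) t5))
  rw [← key] at hrhs
  exact (mul_nonneg_iff_of_pos_left (mul_pos hL1 hL0)).1 hrhs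

/-- **CROSS-FORM STEP LEMMA** (memo Lemma 5 + §3).  If `n ≥ 0` for both section triples at `e`, the sections are monotone, neither section slot
is almost sure, and the ball-conditioned drifts satisfy `U_A ≥ 0 ≥ U_B`, then `n(H;A,B) ≥ 0`. [this work] -/
theorem osN_ind_ind_nonneg_of_cross (p : ι → unitInterval) (H A B : Set (Set ι)) (e : ι)
    (h1 : 0 ≤ osN p {ω : Set ι | insert e ω ∈ H} (ind {ω : Set ι | insert e ω ∈ A}) (ind {ω : Set ι | insert e ω ∈ B}))
    (h0 : 0 ≤ osN p {ω : Set ι | ω \ {e} ∈ H} (ind {ω : Set ι | ω \ {e} ∈ A}) (ind {ω : Set ι | ω \ {e} ∈ B}))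
    (hH1 : (prodBernoulli p).real {ω : Set ι | insert e ω ∈ H} < 1)
    (hH0 : (prodBernoulli p).real {ω : Set ι | ω \ {e} ∈ H} < 1)
    (hA : (prodBernoulli p).real {ω : Set ι | ω \ {e} ∈ A} ≤ (prodBernoulli p).real {ω : Set ι | insert e ω ∈ A})
    (hB : (prodBernoulli p).real {ω : Set ι | ω \ {e} ∈ B} ≤ (prodBernoulli p).real {ω : Set ι | insert e ω ∈ B})
    (hUA : 0 ≤ (1 - (prodBernoulli p).real {ω : Set ι | ω \ {e} ∈ H}) *
          ((prodBernoulli p).real {ω : Set ι | insert e ω ∈ A} - (prodBernoulli p).real ({ω : Set ι | insert e ω ∈ H} ∩ {ω : Set ι | insert e ω ∈ A}))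
        - (1 - (prodBernoulli p).real {ω : Set ι | insert e ω ∈ H}) *
          ((prodBernoulli p).real {ω : Set ι | ω \ {e} ∈ A} - (prodBernoulli p).real ({ω : Set ι | ω \ {e} ∈ H} ∩ {ω : Set ι | ω \ {e} ∈ A})))
    (hUB : (1 - (prodBernoulli p).real {ω : Set ι | ω \ {e} ∈ H}) *
          ((prodBernoulli p).real {ω : Set ι | insert e ω ∈ B} - (prodBernoulli p).real ({ω : Set ι | insert e ω ∈ H} ∩ {ω : Set ι | insert e ω ∈ B}))
        - (1 - (prodBernoulli p).real {ω : Set ι | insert e ω ∈ H}) *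
          ((prodBernoulli p).real {ω : Set ι | ω \ {e} ∈ B} - (prodBernoulli p).real ({ω : Set ι | ω \ {e} ∈ H} ∩ {ω : Set ι | ω \ {e} ∈ B})) ≤ 0) :
    0 ≤ osN p H (ind A) (ind B) := by
  rw [osN_ind_ind_pivot_eq p H A B e]
  exact cross_step_real (p e : ℝ) _ _ _ _ _ _ _ _ _ _ _ _ _ _ (p e).2.1 (sub_nonneg.2 (p e).2.2) hH1 hH0
    (osN_ind_ind p _ _ _) (osN_ind_ind p _ _ _) h1 h0 hA hB hUA hUB

end SahiOneStep

end Summit.CriticalPhenomena.PercolationContinuityZ3.Theorems
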